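import Literature.NumberTheory.DiophantineGeometry.AVIsogenyTateInjectiveProofs
import Literature.AlgebraicGeometry.Motives.AbelianVarietyTorsionCubeProofs
import Literature.NumberTheory.EllipticCurves.TateModuleReductionKernelProofs
import HarnessLib

/-!
# `A(K̄)` is a divisible group; the `p`-rank count `#A[pⁿ](K̄) = p^{fn}`

`Proofs` file (theorems only), topic `NumberTheory/DiophantineGeometry`, sibling of
`AVIsogenyTateInjectiveProofs` (which proves divisibility of `A(K̄)` by integers *invertible in
`K`*, `AbelianVariety.exists_zpow_eq_of_cast_ne_zero`).

* `AbelianVariety.exists_zpow_eq_of_ne_zero`, `AbelianVariety.nsmul_geomPoints_surjective_of_ne_zero`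
  — **`A(K̄)` is divisible**: for *every* integer `n ≠ 0` (also `p = char K`) and every
  `K̄`-point `P` there is `Q` with `Q ^ n = P`.  Mumford, *Abelian Varieties*, §6, Application 2,
  p. 64 ("`X(k)` is a divisible group", `k` algebraically closed, from "`n_X` is an isogeny" for all
  `n ≠ 0`); here from the tree's theorem `isIsogeny_zsmul_id_holds` (Görtz–Wedhorn II,
  Prop. 27.186: `[n]_A` is an isogeny for `n ≠ 0`, any characteristic) and
  `IsIsogeny.exists_comp_eq` (isogenies are onto on `K̄`-points).
* `AbelianVariety.natCard_geomTorsion_pow_of_natCard` — **the `p`-rank count**: if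
  `#A[p](K̄) = p ^ f` then `#A[pⁿ](K̄) = p ^ (f n)` for all `n` (Mumford §15, p. 147: for
  `p = char k`, `A[p^m](k̄) ≅ (ℤ/p^m ℤ)^f` with `0 ≤ f ≤ g` the `p`-rank; Li–Oort, *Moduli of
  supersingular abelian varieties*, §0.6), by divisibility and the counting lemma
  `TateModule.card_torsionBy_pow_of_divisible`.  For the special fibre `𝒜_v` of an abelian scheme
  with *ordinary* reduction (`#𝒜_v[p](κ̄) = p^g`, the tree's `HasGoodOrdinaryReductionAt`) this is
  the count `#𝒜_v[pⁿ](κ̄) = p^{gn}` consumed by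
  `Literature/NumberTheory/EllipticCurves/TateModuleReductionKernelProofs.lean`.

## References

* [MumfordAV1970] D. Mumford, *Abelian Varieties* (1970), §6 Application 2 (p. 64), §15 (p. 147).
* [GortzWedhorn2023] U. Görtz, T. Wedhorn, *Algebraic Geometry II* (2023), Prop. 27.186.
* [LiOort1998] K.-Z. Li, F. Oort, *Moduli of Supersingular Abelian Varieties*, §0.6.
-/

universe u

open CategoryTheory AlgebraicGeometry
open scoped AddSubgroup

noncomputable section

namespace Literature.NumberTheory.DiophantineGeometry

open Literature.AlgebraicGeometry.Motives (AbelianVariety)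
open Literature.AlgebraicGeometry.Motives.AbelianVariety
open scoped MonObj

variable {K : Type u} [Field K] {A : AbelianVariety K}

/-- **`A(K̄)` is divisible** (Mumford, *Abelian Varieties*, §6, Application 2, p. 64: "`X(k)` is a
divisible group"): for every integer `n ≠ 0` — including `n` divisible by the characteristic — and
every `K̄`-point `P` of `A` there is a `K̄`-point `Q` with `Q ^ n = P` (multiplicative notation of
Mathlib's `Hom.commGroup`), because `[n]_A` is an isogeny (`isIsogeny_zsmul_id_holds`,
Görtz–Wedhorn II, Prop. 27.186) and isogenies are onto on `K̄`-points (`IsIsogeny.exists_comp_eq`).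
[cite: MumfordAV1970, §6 Application 2 (p. 64)] -/
theorem _root_.Literature.AlgebraicGeometry.Motives.AbelianVariety.exists_zpow_eq_of_ne_zero
    (n : ℤ) (hn : n ≠ 0) (P : A.Points (AlgebraicClosure K)) :
    ∃ Q : A.Points (AlgebraicClosure K), Q ^ n = P := by
  obtain ⟨Q, hQ⟩ := (isIsogeny_zsmul_id_holds A n hn).exists_comp_eq P
  exact ⟨Q, by rwa [hom_zsmul_id, GrpObj.comp_zpow, Category.comp_id] at hQ⟩

/-- Multiplication by any `m ≠ 0` is onto `A(K̄)` (written additively, `A.geomPoints`): additive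
form of `exists_zpow_eq_of_ne_zero` (Mumford §6, Application 2, p. 64).
[cite: MumfordAV1970, §6 Application 2 (p. 64)] -/
theorem _root_.Literature.AlgebraicGeometry.Motives.AbelianVariety.nsmul_geomPoints_surjective_of_ne_zero
    (m : ℕ) (hm : m ≠ 0) : Function.Surjective fun P : A.geomPoints ↦ m • P := by
  intro P
  obtain ⟨Q, hQ⟩ := exists_zpow_eq_of_ne_zero (A := A) (m : ℤ) (Int.natCast_ne_zero.mpr hm)
    (Additive.toMul P)
  rw [zpow_natCast] at hQ
  refine ⟨Additive.ofMul Q, ?_⟩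
  apply Additive.toMul.injective
  exact hQ

variable (A) in
/-- **The `p`-rank count** (Mumford, *Abelian Varieties*, §15, p. 147; Li–Oort §0.6): if
`#A[p](K̄) = p ^ f` for a prime `p` (e.g. `p = char K`, `f` the `p`-rank) then
`#A[pⁿ](K̄) = p ^ (f n)` for every `n`, `A(K̄)` being `p`-divisible
(`nsmul_geomPoints_surjective_of_ne_zero`) with `[p] : A[pⁿ⁺¹] → A[pⁿ]` onto of kernel `A[p]`
(`TateModule.card_torsionBy_pow_of_divisible`).  For an *ordinary* `g`-dimensional `A` in
characteristic `p` (`f = g`): `#A[pⁿ](K̄) = p^{gn}`. [cite: MumfordAV1970, §15 p. 147 (the p-rank)] -/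
theorem _root_.Literature.AlgebraicGeometry.Motives.AbelianVariety.natCard_geomTorsion_pow_of_natCard
    (p : ℕ) [Fact p.Prime] {f : ℕ} (h1 : Nat.card (A.geomTorsion (p : ℕ)) = p ^ f) (n : ℕ) :
    Nat.card (A.geomTorsion (p ^ n : ℕ)) = p ^ (f * n) :=
  EllipticCurves.TateModule.card_torsionBy_pow_of_divisible
    (fun P ↦ nsmul_geomPoints_surjective_of_ne_zero (A := A) p (Fact.out : p.Prime).ne_zero P) h1 n

end Literature.NumberTheory.DiophantineGeometry
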